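import Mathlib.LinearAlgebra.Matrix.Kronecker
import Mathlib.LinearAlgebra.Matrix.ToLin
import Mathlib.RepresentationTheory.Subrepresentation
import Mathlib.RepresentationTheory.Irreducible
import HarnessLib

/-!
# Clifford–Tate structure: the Kronecker factors of an irreducible representation are irreducible

Pure linear algebra.  If, in some basis `B` indexed by `Fin a × Fin d`, every operator of an
IRREDUCIBLE representation `π` is a Kronecker product `X(g) ⊗ Y(g)`, then the matrix families
`X` and `Y` act irreducibly on `k^a` and `k^d`: a `Y`-stable subspace `W ≤ k^d` gives the
`π`-stable subspace `{v | every row of the coordinate array of v lies in W}` of `V`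
(`rowSubrep`), and symmetrically for `X` with columns (`colSubrep`).
[cite: Clifford1937, Thm. 3] [cite: Zarhin2005Clifford, §3]
-/

set_option autoImplicit false
set_option linter.dupNamespace false

noncomputable section

namespace Summit.Langlands.Langlands.Theorems

open Matrix
open scoped Kronecker

variable {k : Type*} [Field k] {G : Type*} [Group G] {V : Type*} [AddCommGroup V] [Module k V]
  (π : Representation k G V) {a d : ℕ} (B : Module.Basis (Fin a × Fin d) k V)
  (X : G → Matrix (Fin a) (Fin a) k) (Y : G → Matrix (Fin d) (Fin d) k)

/-- Coordinates of `π(g) v` in a Kronecker frame. [folklore] -/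
theorem repr_apply_eq_sum (hXY : ∀ g, LinearMap.toMatrix B B (π g) = X g ⊗ₖ Y g) (g : G) (v : V)
    (y : Fin a) (l : Fin d) :
    B.repr (π g v) (y, l) = ∑ x, ∑ j, X g y x * Y g l j * B.repr v (x, j) := by
  classical
  have h1 := congrFun (LinearMap.toMatrix_mulVec_repr B B (π g) v) (y, l)
  rw [← h1, hXY g, Matrix.mulVec, dotProduct, Fintype.sum_prod_type]
  simp only [kroneckerMap_apply]

/-- The vector with coordinate array supported on the row `y₀`, equal to `w` there. [folklore] -/
def rowVector (y₀ : Fin a) (w : Fin d → k) : V :=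
  B.equivFun.symm fun p => if p.1 = y₀ then w p.2 else 0

/-- Coordinates of `rowVector B y₀ w`: the row `y₀` is `w`, the other rows vanish. [folklore] -/
theorem repr_rowVector (y₀ : Fin a) (w : Fin d → k) (y : Fin a) (l : Fin d) :
    B.repr (rowVector B y₀ w) (y, l) = if y = y₀ then w l else 0 := by
  have h1 := congrFun (B.equivFun.apply_symm_apply fun p : Fin a × Fin d =>
    if p.1 = y₀ then w p.2 else 0) (y, l)
  rw [Module.Basis.equivFun_apply] at h1
  exact h1

/-- The vector with coordinate array supported on the column `l₀`, equal to `w` there.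
[folklore] -/
def colVector (l₀ : Fin d) (w : Fin a → k) : V :=
  B.equivFun.symm fun p => if p.2 = l₀ then w p.1 else 0

/-- Coordinates of `colVector B l₀ w`: the column `l₀` is `w`, the other columns vanish. [folklore] -/
theorem repr_colVector (l₀ : Fin d) (w : Fin a → k) (y : Fin a) (l : Fin d) :
    B.repr (colVector B l₀ w) (y, l) = if l = l₀ then w y else 0 := by
  have h1 := congrFun (B.equivFun.apply_symm_apply fun p : Fin a × Fin d =>
    if p.2 = l₀ then w p.1 else 0) (y, l)
  rw [Module.Basis.equivFun_apply] at h1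
  exact h1

/-- The subrepresentation of vectors all of whose coordinate ROWS lie in a `Y`-stable subspace.
[folklore] -/
def rowSubrep (hXY : ∀ g, LinearMap.toMatrix B B (π g) = X g ⊗ₖ Y g) (W : Submodule k (Fin d → k))
    (hW : ∀ g, ∀ w ∈ W, Y g *ᵥ w ∈ W) : Subrepresentation π where
  toSubmodule :=
    { carrier := {v | ∀ y : Fin a, (fun l => B.repr v (y, l)) ∈ W}
      add_mem' := by
        intro v v' hv hv' y
        have h1 : (fun l => B.repr (v + v') (y, l)) =
            (fun l => B.repr v (y, l)) + fun l => B.repr v' (y, l) := by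
          funext l; simp
        rw [h1]; exact W.add_mem (hv y) (hv' y)
      zero_mem' := by
        intro y
        have h1 : (fun l => B.repr (0 : V) (y, l)) = 0 := by funext l; simp
        rw [h1]; exact W.zero_mem
      smul_mem' := by
        intro c v hv y
        have h1 : (fun l => B.repr (c • v) (y, l)) = c • fun l => B.repr v (y, l) := by
          funext l; simp
        rw [h1]; exact W.smul_mem c (hv y) }
  apply_mem_toSubmodule := by
    intro g v hv y
    have h1 : (fun l => B.repr (π g v) (y, l)) =
        ∑ x, X g y x • (Y g *ᵥ fun j => B.repr v (x, j)) := by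
      funext l
      rw [repr_apply_eq_sum π B X Y hXY, Finset.sum_apply]
      refine Finset.sum_congr rfl fun x _ => ?_
      rw [Pi.smul_apply, Matrix.mulVec, dotProduct, smul_eq_mul, Finset.mul_sum]
      refine Finset.sum_congr rfl fun j _ => ?_
      ring
    rw [h1]
    exact W.sum_mem fun x _ => W.smul_mem _ (hW g _ (hv x))

/-- Membership in `rowSubrep`: every row lies in `W`. [folklore] -/
theorem mem_rowSubrep (hXY : ∀ g, LinearMap.toMatrix B B (π g) = X g ⊗ₖ Y g)
    (W : Submodule k (Fin d → k)) (hW : ∀ g, ∀ w ∈ W, Y g *ᵥ w ∈ W) (v : V) :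
    v ∈ rowSubrep π B X Y hXY W hW ↔ ∀ y : Fin a, (fun l => B.repr v (y, l)) ∈ W := Iff.rfl

/-- The subrepresentation of vectors all of whose coordinate COLUMNS lie in an `X`-stable subspace.
[folklore] -/
def colSubrep (hXY : ∀ g, LinearMap.toMatrix B B (π g) = X g ⊗ₖ Y g) (W : Submodule k (Fin a → k))
    (hW : ∀ g, ∀ w ∈ W, X g *ᵥ w ∈ W) : Subrepresentation π where
  toSubmodule :=
    { carrier := {v | ∀ l : Fin d, (fun y => B.repr v (y, l)) ∈ W}
      add_mem' := by
        intro v v' hv hv' l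
        have h1 : (fun y => B.repr (v + v') (y, l)) =
            (fun y => B.repr v (y, l)) + fun y => B.repr v' (y, l) := by
          funext y; simp
        rw [h1]; exact W.add_mem (hv l) (hv' l)
      zero_mem' := by
        intro l
        have h1 : (fun y => B.repr (0 : V) (y, l)) = 0 := by funext y; simp
        rw [h1]; exact W.zero_mem
      smul_mem' := by
        intro c v hv l
        have h1 : (fun y => B.repr (c • v) (y, l)) = c • fun y => B.repr v (y, l) := by
          funext y; simp
        rw [h1]; exact W.smul_mem c (hv l) }
  apply_mem_toSubmodule := by
    intro g v hv l
    have h1 : (fun y => B.repr (π g v) (y, l)) =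
        ∑ j, Y g l j • (X g *ᵥ fun x => B.repr v (x, j)) := by
      funext y
      rw [repr_apply_eq_sum π B X Y hXY, Finset.sum_apply, Finset.sum_comm]
      refine Finset.sum_congr rfl fun j _ => ?_
      rw [Pi.smul_apply, Matrix.mulVec, dotProduct, smul_eq_mul, Finset.mul_sum]
      refine Finset.sum_congr rfl fun x _ => ?_
      ring
    rw [h1]
    exact W.sum_mem fun j _ => W.smul_mem _ (hW g _ (hv j))

/-- Membership in `colSubrep`: every column lies in `W`. [folklore] -/
theorem mem_colSubrep (hXY : ∀ g, LinearMap.toMatrix B B (π g) = X g ⊗ₖ Y g)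
    (W : Submodule k (Fin a → k)) (hW : ∀ g, ∀ w ∈ W, X g *ᵥ w ∈ W) (v : V) :
    v ∈ colSubrep π B X Y hXY W hW ↔ ∀ l : Fin d, (fun y => B.repr v (y, l)) ∈ W := Iff.rfl

/-- **The right Kronecker factor of an irreducible representation acts irreducibly.**
[cite: Clifford1937, Thm. 3] -/
theorem right_factor_irreducible [π.IsIrreducible] (ha : 0 < a)
    (hXY : ∀ g, LinearMap.toMatrix B B (π g) = X g ⊗ₖ Y g) (W : Submodule k (Fin d → k))
    (hW : ∀ g, ∀ w ∈ W, Y g *ᵥ w ∈ W) : W = ⊥ ∨ W = ⊤ := by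
  classical
  by_contra h
  push Not at h
  obtain ⟨hb, ht⟩ := h
  let y₀ : Fin a := ⟨0, ha⟩
  have hrow : ∀ (w : Fin d → k) (y : Fin a), (fun l => B.repr (rowVector B y₀ w) (y, l)) =
      if y = y₀ then w else 0 := by
    intro w y
    funext l
    rw [repr_rowVector]
    split_ifs <;> rfl
  rcases IsSimpleOrder.eq_bot_or_eq_top (rowSubrep π B X Y hXY W hW) with h | h
  · apply hb
    rw [eq_bot_iff]
    intro w hw
    have hv : rowVector B y₀ w ∈ rowSubrep π B X Y hXY W hW := by
      rw [mem_rowSubrep]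
      intro y
      rw [hrow]
      split_ifs
      · exact hw
      · exact W.zero_mem
    rw [h] at hv
    have hv0 : rowVector B y₀ w = 0 := hv
    rw [Submodule.mem_bot]
    funext l
    have h1 := repr_rowVector B y₀ w y₀ l
    rw [hv0, map_zero, Finsupp.zero_apply, if_pos rfl] at h1
    exact h1.symm
  · apply ht
    rw [eq_top_iff]
    intro w _
    have hv : rowVector B y₀ w ∈ rowSubrep π B X Y hXY W hW := by
      rw [h]; exact Submodule.mem_top
    rw [mem_rowSubrep] at hv
    have h1 := hv y₀
    rw [hrow, if_pos rfl] at h1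
    exact h1

/-- **The left Kronecker factor of an irreducible representation acts irreducibly.**
[cite: Clifford1937, Thm. 3] -/
theorem left_factor_irreducible [π.IsIrreducible] (hd : 0 < d)
    (hXY : ∀ g, LinearMap.toMatrix B B (π g) = X g ⊗ₖ Y g) (W : Submodule k (Fin a → k))
    (hW : ∀ g, ∀ w ∈ W, X g *ᵥ w ∈ W) : W = ⊥ ∨ W = ⊤ := by
  classical
  by_contra h
  push Not at h
  obtain ⟨hb, ht⟩ := h
  let l₀ : Fin d := ⟨0, hd⟩
  have hcol : ∀ (w : Fin a → k) (l : Fin d), (fun y => B.repr (colVector B l₀ w) (y, l)) =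
      if l = l₀ then w else 0 := by
    intro w l
    funext y
    rw [repr_colVector]
    split_ifs <;> rfl
  rcases IsSimpleOrder.eq_bot_or_eq_top (colSubrep π B X Y hXY W hW) with h | h
  · apply hb
    rw [eq_bot_iff]
    intro w hw
    have hv : colVector B l₀ w ∈ colSubrep π B X Y hXY W hW := by
      rw [mem_colSubrep]
      intro l
      rw [hcol]
      split_ifs
      · exact hw
      · exact W.zero_mem
    rw [h] at hv
    have hv0 : colVector B l₀ w = 0 := hv
    rw [Submodule.mem_bot]
    funext y
    have h1 := repr_colVector B l₀ w y l₀
    rw [hv0, map_zero, Finsupp.zero_apply, if_pos rfl] at h1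
    exact h1.symm
  · apply ht
    rw [eq_top_iff]
    intro w _
    have hv : colVector B l₀ w ∈ colSubrep π B X Y hXY W hW := by
      rw [h]; exact Submodule.mem_top
    rw [mem_colSubrep] at hv
    have h1 := hv l₀
    rw [hcol, if_pos rfl] at h1
    exact h1

end Summit.Langlands.Langlands.Theorems

end
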